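import Summits.AnomalousDissipation.AnomalousDissipation.Theorems.SawtoothPulseCascadeK1LocalisedCascadeSymbolFibreTools

/-!
# K1loc, line `Spectral` / SeqCone — helper: V-FIBRE TAYLOR DATA OF THE CONCRETE SYMBOLS (S-B symbol data, V half-slot)

Helper file of the prover lane on the crux `K1LocalisedCascade` (stmt-AnomalousDissipation-19491), route
`SawtoothPulseCascade` (memo v6 addendum §C: "V fibres … still open"; glue seat k1loc-p3).  On the V half-slot of a phase
the fibres are `k_v = n′` and the fibre coordinate is `t = k_h`; the max-compatibility step (`…SlotFibreMax`, discrete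
Taylor hypotheses `hT`, `hT₂` via `…SlotTaylorSymbol.symbol_taylor_hT`) needs, for the concrete symbols of `…SymbolLattice`,
smoothness and all-orders sup bounds of
* the OLD symbol `μ_V(t) = 1 − g^M_{L₀}(t, n′) = 1 − sT((|t| − L₀)/(εL₀))·(1 − sT((γ|n′ + γt| − a₂|t|)/(ε_aL₀))·sT((γ|n′ − γt| − a₂|t|)/(ε_aL₀)))`,
* the squared shifted NEW symbol `ν_V(t) = (1 − g^S_L(t − b′, n′))² = (1 − sT((|t − b′| − L)/(εL))·(1 − sT((γ|n′| − a|t − b′|)/(ε_aL))))²`.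
Near each point these are `1` or of the shape `1 − sT(p₁ + q₁t)·(1 − sT(p₂ + q₂t)·sT(p₃ + q₃t))` (`…SymbolFibreTools`), whence:
`contDiff_symM_fibreV`, `exists_bound_iteratedDeriv_symM_fibreV` (`|μ_V⁽ʳ⁾| ≤ C_r/bʳ` for `b ≤ εL₀`, `b(γ² + a₂) ≤ ε_aL₀`),
`contDiff_symS_fibreV_sq`, `exists_bound_iteratedDeriv_symS_fibreV_sq` (`|ν_V⁽ʳ⁾| ≤ C_r/bʳ` for `b ≤ εL`, `b·a ≤ ε_aL`), with
`C_r` depending on `r` only (uniform in the phase, the fibre `n′`, the shift `b′` and `γ`).  No definitions; no statement about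
the stub.  [cite: Grafakos2014, Prop. 3.1.2 (5)] [problem: turb]
-/

-- `Summit.<Summit>.<Problem>`: single-conjunct summit, the duplicate namespace segment is deliberate.
set_option linter.dupNamespace false

noncomputable section

namespace Summit.AnomalousDissipation.AnomalousDissipation.Theorems.SawtoothPulseCascade.K1Cutoff

open Set Filter Topology Real
open scoped ContDiff

/-- `|q| ≤ N/D`, `b·N ≤ D` (`D > 0`, `b ≥ 0`) give `|q|·b ≤ 1` — the form in which the scale hypotheses are used. [folklore] -/
theorem abs_mul_le_one_of_le_div {q b N D : ℝ} (hD : 0 < D) (hq : |q| ≤ N / D) (hb : 0 ≤ b) (h : b * N ≤ D) :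
    |q| * b ≤ 1 :=
  calc |q| * b ≤ N / D * b := mul_le_mul_of_nonneg_right hq hb
    _ = b * N / D := by ring
    _ ≤ 1 := (div_le_one hD).mpr h

/-! ## The old mid-phase symbol along a V-fibre: `μ_V(t) = 1 − g^M(t, n′)` -/

/-- **Local form of `μ_V`.**  For `ε, ε_a, a₂, L₀ > 0`, near every `x` the profile `μ_V` is either identically `1`
(`|x| < L₀`) or of the shape `1 − sT(p₁ + q₁t)·(1 − sT(p₂ + q₂t)·sT(p₃ + q₃t))` with `|q₁| ≤ 1/(εL₀)`,
`|q₂|, |q₃| ≤ (γ² + a₂)/(ε_aL₀)`. [folklore] -/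
theorem symM_fibreV_locally {γ ε εa a₂ L₀ : ℝ} (hε : 0 < ε) (hεa : 0 < εa) (ha₂ : 0 < a₂) (hL₀ : 0 < L₀) (n' x : ℝ) :
    ((fun t : ℝ => 1 - smoothTransition ((|t| - L₀) / (ε * L₀)) *
        (1 - smoothTransition ((γ * |n' + γ * t| - a₂ * |t|) / (εa * L₀)) *
          smoothTransition ((γ * |n' - γ * t| - a₂ * |t|) / (εa * L₀)))) =ᶠ[𝓝 x] fun _ => (1 : ℝ)) ∨
    ∃ p₁ q₁ p₂ q₂ p₃ q₃ : ℝ, |q₁| ≤ 1 / (ε * L₀) ∧ |q₂| ≤ (γ ^ 2 + a₂) / (εa * L₀) ∧ |q₃| ≤ (γ ^ 2 + a₂) / (εa * L₀) ∧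
      ((fun t : ℝ => 1 - smoothTransition ((|t| - L₀) / (ε * L₀)) *
        (1 - smoothTransition ((γ * |n' + γ * t| - a₂ * |t|) / (εa * L₀)) *
          smoothTransition ((γ * |n' - γ * t| - a₂ * |t|) / (εa * L₀)))) =ᶠ[𝓝 x]
        fun t => 1 - smoothTransition (p₁ + q₁ * t) *
          (1 - smoothTransition (p₂ + q₂ * t) * smoothTransition (p₃ + q₃ * t))) := by
  by_cases hx : |x| < L₀
  · left
    have hopen : IsOpen {t : ℝ | |t| < L₀} := isOpen_lt continuous_abs continuous_const
    filter_upwards [hopen.mem_nhds (show x ∈ {t : ℝ | |t| < L₀} from hx)] with t ht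
    have ht' : |t| < L₀ := ht
    rw [Real.smoothTransition.zero_of_nonpos (div_nonpos_of_nonpos_of_nonneg (by linarith) (mul_pos hε hL₀).le),
      zero_mul, sub_zero]
  · right
    have hx0 : x ≠ 0 := fun h => hx (by rw [h, abs_zero]; exact hL₀)
    obtain ⟨p₁, q₁, hq₁, h₁⟩ := radial_locally_affine hε hL₀ x
    obtain ⟨p₂, q₂, hq₂, h₂⟩ := coneStep_locally_affine_add (γ := γ) (n' := n') (mul_pos hεa hL₀) ha₂ hx0
    obtain ⟨p₃, q₃, hq₃, h₃⟩ := coneStep_locally_affine_sub (γ := γ) (n' := n') (mul_pos hεa hL₀) ha₂ hx0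
    refine ⟨p₁, q₁, p₂, q₂, p₃, q₃, hq₁, hq₂, hq₃, ?_⟩
    filter_upwards [h₁, h₂, h₃] with t ht₁ ht₂ ht₃
    rw [ht₁, ht₂, ht₃]

/-- **`μ_V` is smooth** (`ε, ε_a, a₂, L₀ > 0`). [folklore] -/
theorem contDiff_symM_fibreV {γ ε εa a₂ L₀ : ℝ} (hε : 0 < ε) (hεa : 0 < εa) (ha₂ : 0 < a₂) (hL₀ : 0 < L₀) (n' : ℝ)
    {m : ℕ∞} :
    ContDiff ℝ m (fun t : ℝ => 1 - smoothTransition ((|t| - L₀) / (ε * L₀)) *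
        (1 - smoothTransition ((γ * |n' + γ * t| - a₂ * |t|) / (εa * L₀)) *
          smoothTransition ((γ * |n' - γ * t| - a₂ * |t|) / (εa * L₀)))) := by
  refine contDiff_iff_contDiffAt.2 fun x => ?_
  rcases symM_fibreV_locally (γ := γ) hε hεa ha₂ hL₀ n' x with h | ⟨p₁, q₁, p₂, q₂, p₃, q₃, -, -, -, h⟩
  · exact (contDiffAt_const.congr_of_eventuallyEq h)
  · exact ((contDiff_oneSubMulOneSubMul p₁ q₁ p₂ q₂ p₃ q₃).of_le (by exact_mod_cast le_top)).contDiffAt.congr_of_eventuallyEq h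

/-- **All-orders Taylor data of `μ_V`.**  For every order `r` there is `C_r ≥ 0` such that for all `ε, ε_a, a₂, L₀ > 0`, every
scale `0 < b` with `b ≤ εL₀` and `b(γ² + a₂) ≤ ε_aL₀`, every fibre `n′ ∈ ℤ` and every `t`:
`|μ_V⁽ʳ⁾(t)| ≤ C_r/bʳ`. (The hypothesis `hL` of `…SlotTaylorSymbol.symbol_taylor_hT` and the derivative-symbol bounds
`hMα` of the expansion, for the old symbol of a V half-slot.) [cite: Grafakos2014, Prop. 3.1.2 (5)] -/
theorem exists_bound_iteratedDeriv_symM_fibreV (r : ℕ) :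
    ∃ C : ℝ, 0 ≤ C ∧ ∀ {γ ε εa a₂ L₀ b : ℝ}, 0 < ε → 0 < εa → 0 < a₂ → 0 < L₀ → 0 < b → b ≤ ε * L₀ →
      b * (γ ^ 2 + a₂) ≤ εa * L₀ → ∀ (n' : ℤ) (x : ℝ),
      |iteratedDeriv r (fun t : ℝ => 1 - smoothTransition ((|t| - L₀) / (ε * L₀)) *
        (1 - smoothTransition ((γ * |(n' : ℝ) + γ * t| - a₂ * |t|) / (εa * L₀)) *
          smoothTransition ((γ * |(n' : ℝ) - γ * t| - a₂ * |t|) / (εa * L₀)))) x| ≤ C / b ^ r := by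
  obtain ⟨C, hC0, hC⟩ := exists_bound_iteratedDeriv_oneSubMulOneSubMul r
  refine ⟨C + 1, by linarith, ?_⟩
  intro γ ε εa a₂ L₀ b hε hεa ha₂ hL₀ hb hb₁ hb₂ n' x
  have hmono : C / b ^ r ≤ (C + 1) / b ^ r := div_le_div_of_nonneg_right (by linarith) (pow_pos hb r).le
  rcases symM_fibreV_locally (γ := γ) hε hεa ha₂ hL₀ (n' : ℝ) x with h | ⟨p₁, q₁, p₂, q₂, p₃, q₃, hq₁, hq₂, hq₃, h⟩
  · rw [h.iteratedDeriv_eq, iteratedDeriv_const]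
    split_ifs with hr
    · subst hr; rw [pow_zero, div_one, abs_one]; linarith
    · rw [abs_zero]; positivity
  · rw [h.iteratedDeriv_eq]
    refine (hC hb ?_ ?_ ?_ x).trans hmono
    · exact abs_mul_le_one_of_le_div (mul_pos hε hL₀) hq₁ hb.le (by linarith)
    · exact abs_mul_le_one_of_le_div (mul_pos hεa hL₀) hq₂ hb.le hb₂
    · exact abs_mul_le_one_of_le_div (mul_pos hεa hL₀) hq₃ hb.le hb₂

/-! ## The new start-of-phase symbol along a V-fibre, squared and shifted: `ν_V(t) = (1 − g^S(t − b′, n′))²` -/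

/-- **Local form of the unshifted profile `1 − g^S(t, n′)`.**  For `ε, ε_a, L > 0`, near every `x` it is either identically
`1` (`|x| < L`) or of the shape `1 − sT(p₁ + q₁t)·(1 − sT(p₂ + q₂t)·sT(p₃ + q₃t))` with `|q₁| ≤ 1/(εL)`, `|q₂| ≤ |a|/(ε_aL)`,
`q₃ = 0`. [folklore] -/
theorem symS_fibreV_locally {γ ε εa a L : ℝ} (hε : 0 < ε) (hεa : 0 < εa) (hL : 0 < L) (n' x : ℝ) :
    ((fun t : ℝ => 1 - smoothTransition ((|t| - L) / (ε * L)) *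
        (1 - smoothTransition ((γ * |n'| - a * |t|) / (εa * L)))) =ᶠ[𝓝 x] fun _ => (1 : ℝ)) ∨
    ∃ p₁ q₁ p₂ q₂ p₃ q₃ : ℝ, |q₁| ≤ 1 / (ε * L) ∧ |q₂| ≤ |a| / (εa * L) ∧ q₃ = 0 ∧
      ((fun t : ℝ => 1 - smoothTransition ((|t| - L) / (ε * L)) *
        (1 - smoothTransition ((γ * |n'| - a * |t|) / (εa * L)))) =ᶠ[𝓝 x]
        fun t => 1 - smoothTransition (p₁ + q₁ * t) *
          (1 - smoothTransition (p₂ + q₂ * t) * smoothTransition (p₃ + q₃ * t))) := by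
  by_cases hx : |x| < L
  · left
    have hopen : IsOpen {t : ℝ | |t| < L} := isOpen_lt continuous_abs continuous_const
    filter_upwards [hopen.mem_nhds (show x ∈ {t : ℝ | |t| < L} from hx)] with t ht
    have ht' : |t| < L := ht
    rw [Real.smoothTransition.zero_of_nonpos (div_nonpos_of_nonpos_of_nonneg (by linarith) (mul_pos hε hL).le),
      zero_mul, sub_zero]
  · right
    have hx0 : x ≠ 0 := fun h => hx (by rw [h, abs_zero]; exact hL)
    obtain ⟨p₁, q₁, hq₁, h₁⟩ := radial_locally_affine hε hL x
    obtain ⟨p₂, q₂, hq₂, h₂⟩ := slab_locally_affine (a := a) (κ := γ * |n'|) (mul_pos hεa hL) hx0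
    refine ⟨p₁, q₁, p₂, q₂, 1, 0, hq₁, hq₂, rfl, ?_⟩
    filter_upwards [h₁, h₂] with t ht₁ ht₂
    rw [ht₁, ht₂, zero_mul, add_zero, Real.smoothTransition.one, mul_one]

/-- **`1 − g^S(·, n′)` is smooth** (`ε, ε_a, L > 0`). [folklore] -/
theorem contDiff_symS_fibreV {γ ε εa a L : ℝ} (hε : 0 < ε) (hεa : 0 < εa) (hL : 0 < L) (n' : ℝ) {m : ℕ∞} :
    ContDiff ℝ m (fun t : ℝ => 1 - smoothTransition ((|t| - L) / (ε * L)) *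
        (1 - smoothTransition ((γ * |n'| - a * |t|) / (εa * L)))) := by
  refine contDiff_iff_contDiffAt.2 fun x => ?_
  rcases symS_fibreV_locally (γ := γ) (a := a) hε hεa hL n' x with h | ⟨p₁, q₁, p₂, q₂, p₃, q₃, -, -, -, h⟩
  · exact (contDiffAt_const.congr_of_eventuallyEq h)
  · exact ((contDiff_oneSubMulOneSubMul p₁ q₁ p₂ q₂ p₃ q₃).of_le (by exact_mod_cast le_top)).contDiffAt.congr_of_eventuallyEq h

/-- **All-orders Taylor data of `1 − g^S(·, n′)`** (unshifted): `C_r ≥ 0` depending on `r` only, valid for `ε, ε_a, L, a > 0`,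
`0 < b ≤ εL`, `b·a ≤ ε_aL`. [cite: Grafakos2014, Prop. 3.1.2 (5)] -/
theorem exists_bound_iteratedDeriv_symS_fibreV (r : ℕ) :
    ∃ C : ℝ, 0 ≤ C ∧ ∀ {γ ε εa a L b : ℝ}, 0 < ε → 0 < εa → 0 < a → 0 < L → 0 < b → b ≤ ε * L → b * a ≤ εa * L →
      ∀ (n' x : ℝ), |iteratedDeriv r (fun t : ℝ => 1 - smoothTransition ((|t| - L) / (ε * L)) *
        (1 - smoothTransition ((γ * |n'| - a * |t|) / (εa * L)))) x| ≤ C / b ^ r := by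
  obtain ⟨C, hC0, hC⟩ := exists_bound_iteratedDeriv_oneSubMulOneSubMul r
  refine ⟨C + 1, by linarith, ?_⟩
  intro γ ε εa a L b hε hεa ha hL hb hb₁ hb₂ n' x
  have hmono : C / b ^ r ≤ (C + 1) / b ^ r := div_le_div_of_nonneg_right (by linarith) (pow_pos hb r).le
  rcases symS_fibreV_locally (γ := γ) (a := a) hε hεa hL n' x with h | ⟨p₁, q₁, p₂, q₂, p₃, q₃, hq₁, hq₂, hq₃, h⟩
  · rw [h.iteratedDeriv_eq, iteratedDeriv_const]
    split_ifs with hr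
    · subst hr; rw [pow_zero, div_one, abs_one]; linarith
    · rw [abs_zero]; positivity
  · rw [h.iteratedDeriv_eq]
    refine (hC hb ?_ ?_ ?_ x).trans hmono
    · exact abs_mul_le_one_of_le_div (mul_pos hε hL) hq₁ hb.le (by linarith)
    · exact abs_mul_le_one_of_le_div (mul_pos hεa hL) hq₂ hb.le (by rwa [abs_of_pos ha])
    · rw [hq₃, abs_zero, zero_mul]; exact zero_le_one

/-- **`ν_V` is smooth**: the squared shifted new symbol `(1 − g^S(t − b′, n′))²` (`ε, ε_a, L > 0`). [folklore] -/
theorem contDiff_symS_fibreV_sq {γ ε εa a L : ℝ} (hε : 0 < ε) (hεa : 0 < εa) (hL : 0 < L) (n' b' : ℝ) {m : ℕ∞} :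
    ContDiff ℝ m (fun t : ℝ => (1 - smoothTransition ((|t - b'| - L) / (ε * L)) *
        (1 - smoothTransition ((γ * |n'| - a * |t - b'|) / (εa * L)))) ^ 2) := by
  have h := (contDiff_symS_fibreV (γ := γ) (a := a) hε hεa hL n' (m := m)).comp
    ((contDiff_id (𝕜 := ℝ) (E := ℝ)).sub (contDiff_const (c := b')))
  exact h.pow 2

/-- **All-orders Taylor data of `ν_V`** (hypothesis `hT₂` / bounds of `νd` on a V half-slot): for every `r` there is
`C_r ≥ 0` such that for all `ε, ε_a, a, L > 0`, `0 < b ≤ εL`, `b·a ≤ ε_aL`, all `n′, b′ ∈ ℤ` and all `t`: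
`|((1 − g^S(· − b′, n′))²)⁽ʳ⁾(t)| ≤ C_r/bʳ`. [cite: Grafakos2014, Prop. 3.1.2 (5)] -/
theorem exists_bound_iteratedDeriv_symS_fibreV_sq (r : ℕ) :
    ∃ C : ℝ, 0 ≤ C ∧ ∀ {γ ε εa a L b : ℝ}, 0 < ε → 0 < εa → 0 < a → 0 < L → 0 < b → b ≤ ε * L → b * a ≤ εa * L →
      ∀ (n' b' : ℤ) (x : ℝ), |iteratedDeriv r (fun t : ℝ => (1 - smoothTransition ((|t - b'| - L) / (ε * L)) *
        (1 - smoothTransition ((γ * |(n' : ℝ)| - a * |t - b'|) / (εa * L)))) ^ 2) x| ≤ C / b ^ r := by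
  choose C hC0 hC using exists_bound_iteratedDeriv_symS_fibreV
  refine ⟨∑ i ∈ Finset.range (r + 1), (r.choose i : ℝ) * C i * C (r - i),
    Finset.sum_nonneg fun i _ => by have := hC0 i; have := hC0 (r - i); positivity, ?_⟩
  intro γ ε εa a L b hε hεa ha hL hb hb₁ hb₂ n' b' x
  -- remove the shift
  have hshift : iteratedDeriv r (fun t : ℝ => (1 - smoothTransition ((|t - b'| - L) / (ε * L)) *
      (1 - smoothTransition ((γ * |(n' : ℝ)| - a * |t - b'|) / (εa * L)))) ^ 2) x =
      iteratedDeriv r (fun t : ℝ => (1 - smoothTransition ((|t| - L) / (ε * L)) *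
      (1 - smoothTransition ((γ * |(n' : ℝ)| - a * |t|) / (εa * L)))) ^ 2) (x - b') := by
    rw [iteratedDeriv_comp_sub_const r (fun t : ℝ => (1 - smoothTransition ((|t| - L) / (ε * L)) *
      (1 - smoothTransition ((γ * |(n' : ℝ)| - a * |t|) / (εa * L)))) ^ 2) (b' : ℝ)]
  rw [hshift]
  exact abs_iteratedDeriv_sq_le_of_scale (contDiff_symS_fibreV (γ := γ) (a := a) hε hεa hL (n' : ℝ)) hb
    (fun i _ y => hC i hε hεa ha hL hb hb₁ hb₂ (n' : ℝ) y) (x - b')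

end Summit.AnomalousDissipation.AnomalousDissipation.Theorems.SawtoothPulseCascade.K1Cutoff
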